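import Mathlib
import Literature.MathematicalPhysics.QuantumLattice.FermiRG.Salmhofer1998DotCovKernelCalculus
import Literature.MathematicalPhysics.QuantumLattice.FermiRG.Salmhofer1998DotCovDecay
import Literature.MathematicalPhysics.QuantumLattice.FermiRG.Salmhofer1998SublevelVolume
import Literature.MathematicalPhysics.QuantumLattice.FermiRG.Salmhofer1998MatsubaraSums
import HarnessLib

/-!
# Salmhofer 1998, Lemma 4 completed: the `𝐩`-derivative bounds (5.18) for all orders, the
# Matsubara count (5.19′), the integrated bounds (5.19)–(5.20), and (5.21) `∫|D̂_t| ≤ 8J₁ε_t` — PROOFS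

M. Salmhofer, *Continuous renormalization for fermions and Fermi liquid theory*, Commun. Math. Phys.
**194** (1998) 249–295 = arXiv:cond-mat/9706188 [Salmhofer1998], §5.4, Lemma 4 (render
`paper:arxiv-cond-mat_9706188`: statement p.19 L132–166, proof p.20 L1–36; locators `p.N Ln` = chunk
`pNNNN.txt` line `n` of the materialised arXiv TeX, NOT printed pages; stable locators are the paper's
numbers (5.18)–(5.21)).

Theorem-only companion of the FROZEN statement file `Salmhofer1998Sec5.lean` (t7, gate-hubbard-kl
wave; no new definition, no named fact, net debt `0`).  The statement file types (5.21) as the predicate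
`Display521 M χ₁ β J₁ t` (`∫_{ℝ×𝓑} d^{d+1}p/(2π)^{d+1} |D̂_t(p)| ≤ 8J₁ε_t`) and leaves Lemma 4 itself untyped
(its docstring: "Lemma 4 (F-085) … is NOT typed"); the companion `Salmhofer1998Sec5PropagatorLemmas`
proves the scalar part (boundedness, `C^∞` in `t`, vanishing for `t > log(βε₀/π)`, (5.18) at `α = 0`
with `B₀ = 4`).  THIS file proves the rest of Lemma 4 for the §2.3 class of models (`ModelData.Hyp`)
and any cutoff `χ₁` (`IsCutoff`), following the printed proof (p.20 L1–36) step by step: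

* **"`C^{k₀}` in `𝐩`"** (Lemma 4, first sentence): `𝐩 ↦ D̂_t(p₀,𝐩)` and `𝐩 ↦ Ḋ̂_t(p₀,𝐩)` are `C^{k₀}`
  (`contDiff_cutoffCovInf_snd`, `contDiff_deriv_cutoffCovInf_snd`).
* **(5.18) for all `|α| ≤ k₀`** (`exists_bound_display518`): there are constants `B_m > 0`, `B₀ = 4`,
  depending on the model and `χ₁` only, with
  `‖D^m_𝐩 Ḋ̂_t(p)‖ ≤ B_m ε_t^{-1-m} 1(|iω_β(p₀) - E(𝐩)| ≤ ε_t) ≤ B_m ε_t^{-1-m} 1(|ω_β(p₀)| ≤ ε_t) 1(|E(𝐩)| ≤ ε_t)`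
  for all `t ≥ 0`, all `β`, all `p`.  "Derivatives with respect to `𝐩` can act on `E(𝐩)` or on `χ₁'`, in
  which case they produce factors bounded by `ε_t⁻¹|∇E(𝐩)|`" (p.20 L10–13) is Faà di Bruno's formula
  (Mathlib's `norm_iteratedFDeriv_comp_le`) for `Ḋ̂_t(p₀,·) = g ∘ E` with `g(y) = ε_t⁻¹Φ(ω_β(p₀)/ε_t, y/ε_t)`
  the scaled profile of toolkit I (`covCDot_eq_scaledSlice`, `‖g^{(i)}‖ ≤ C ε_t^{-1-i}`) and the Fréchet
  derivatives of the periodic `C^{k₀}` dispersion relation bounded (`exists_bound_iteratedFDeriv_periodic`).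
  CONVENTION: `D^α`, `|α| = m`, is rendered by the full `m`-th Fréchet derivative
  `iteratedFDeriv ℝ m (Ḋ̂_t(p₀,·)) 𝐩`, whose operator norm dominates every coordinate partial `D^α Ḋ̂_t(p)`
  (`norm_iteratedFDeriv_apply_coord_le`); `B_α` is taken to depend on `|α|` only.
* **(5.19′)** (`volume_abs_omegaStep_le`): `vol{p₀ : |ω_β(p₀)| ≤ ε} ≤ 4ε`, i.e.
  `M_β = ∫dp₀/(2π) 1(|ω_β(p₀)| ≤ ε) = β⁻¹ #{n : |2n+1| ≤ βε/π} ≤ (2/π)ε` (p.20 L19–22; Matsubara counting of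
  toolkit IV, `exists_matsubara_support`).
* **(5.19), (5.20)** (in `lemma4`): "Inserting (5.18) into the integral" — the `p₀`-integral and the
  `ℝ × 𝓑`-integral of the indicator majorant (`lintegral_le_of_le_omegaStep_indicator`,
  `setLIntegral_prod_le_of_le_indicator`), with the shell volume `vol{𝐩 ∈ 𝓑 : |E(𝐩)| ≤ ε} ≤ C_E ε` of
  toolkit III (`exists_sublevel_volume_le`) in place of the change of coordinates
  "`∫_𝓑 1(|E| ≤ ε_t) ≤ ∫_{-ε_t}^{ε_t}dρ ∫dθ |J(ρ,θ)| = 2J₁ε_t`" (p.20 L28–34): HERE `J₁ := C_E'/(2(2π)^d)` with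
  `C_E' = C_E + 1`, so that `∫_𝓑 d^d𝐩/(2π)^d 1(|E(𝐩)| ≤ ε) ≤ 2J₁ε` holds for `0 < ε ≤ 1` — this inequality,
  the only property of `J₁` the printed proof uses, is part of the conclusion of `lemma4`.
* **(5.21)** (`lemma4`, `exists_display521`): "follows by integration over `t`" (p.20 L35–36):
  `D̂_t(p) = -∫_t^T Ḋ̂_s(p) ds` for `T > log(βε₀/π)` (FTC, `D̂_T ≡ 0`), `‖D̂_t(p)‖ ≤ ∫_t^T ‖Ḋ̂_s(p)‖ds`, Tonelli,
  (5.20) at `α = 0` (`= 16 C_E' ε_s`), `∫_t^∞ ε_s ds = ε_t`; whence `covL1Momentum ≤ (8/π)·(C_E'/(2π)^d)·ε_t ≤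
  8J₁ε_t`, i.e. `∃ J₁ > 0, ∀ β > 0, ∀ t ≥ 0, Display521 M χ₁ β J₁ t` — the hypothesis shape consumed by
  `ManyFermionGreenFunctionBound` (F7b) in the thermodynamic limit.

Scope, honestly: print states (5.19)–(5.21) "for `t ≤ log(βε₀/π)`"; they are proved here for all `t ≥ 0`
(beyond `log(βε₀/π)` the left sides vanish).  `t ≥ 0` (the flow range, p.18 L19–25) is used through
`ε_t ≤ ε₀ ≤ 1`.  `β > 0` throughout (for (5.18) and the regularity of `Ḋ̂_t` any `β`).  Constants: (5.19)
carries print's `B_α ε_t^{-|α|}` exactly (print rounds `M_β ≤ (2/π)ε_t` up to `ε_t`; here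
`(2π)⁻¹ · 4ε_t ≤ ε_t`); (5.20) carries `2J₁B_α ε_t^{1-|α|}` and (5.21) `8J₁ε_t` with the `J₁` above.  Powers
`ε_t^{-1-m}`, `ε_t^{-m}`, `ε_t^{1-m}` are written `(ε_t⁻¹)^{m+1}`, `(ε_t⁻¹)^m`, `(ε_t⁻¹)^m ε_t`.  Integrals
are Lebesgue integrals `∫⁻` of norms (no integrability side conditions; the integrands are measurable,
`measurable_deriv_cutoffCovInf`, but the bounds do not need it except in the Tonelli step of (5.21)).

No `instance`, no `notation`, no sorry/axiom; nothing about the Hubbard model is asserted or denied.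
-/

noncomputable section

open Filter Function MeasureTheory Set
open scoped Topology ContDiff ENNReal Nat

namespace Literature.MathematicalPhysics.QuantumLattice.FermiRG

namespace Salmhofer1998

variable {d : ℕ}

/-! ### Fréchet derivatives of the periodic dispersion relation are bounded -/

/-- Periodicity is inherited by all Fréchet derivatives. [cite: Salmhofer1998, §2.3 (p.6 L142–157)] -/
theorem iteratedFDeriv_periodic {E : (Fin d → ℝ) → ℝ} {c : Fin d → ℝ} (hper : ∀ k, E (k + c) = E k)
    (i : ℕ) (k : Fin d → ℝ) : iteratedFDeriv ℝ i E (k + c) = iteratedFDeriv ℝ i E k := by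
  have h : (fun z => E (z + c)) = E := funext hper
  rw [← iteratedFDeriv_comp_add_right i c k, h]

/-- **Uniform bounds on the Fréchet derivatives of the dispersion relation**: for `E ∈ C^N(ℝ^d)`
periodic under `Pℤ^d` there is `D ≥ 1` with `‖DⁱE(𝐤)‖ ≤ Dⁱ` for all `1 ≤ i ≤ N` and all `𝐤` — the
"factors bounded by `ε_t⁻¹|∇E(𝐩)|`" (and higher derivatives of `E`) of the printed proof are finite because
`E ∈ C^{k₀}` is periodic and continuous periodic functions are bounded (`exists_bound_of_periodic`).
[cite: Salmhofer1998, §2.3 (p.6 L144–157); Lemma 4 proof (p.20 L10–13)] -/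
theorem exists_bound_iteratedFDeriv_periodic {E : (Fin d → ℝ) → ℝ} {N : ℕ} (hE : ContDiff ℝ N E)
    {P : ℝ} (hP : 0 < P)
    (hper : ∀ (k : Fin d → ℝ) (z : Fin d → ℤ), E (k + fun i => P * (z i : ℝ)) = E k) :
    ∃ D : ℝ, 1 ≤ D ∧ ∀ i : ℕ, 1 ≤ i → i ≤ N → ∀ k : Fin d → ℝ, ‖iteratedFDeriv ℝ i E k‖ ≤ D ^ i := by
  have hb : ∀ i : ℕ, i ≤ N → ∃ C : ℝ, 0 ≤ C ∧ ∀ k, ‖iteratedFDeriv ℝ i E k‖ ≤ C := by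
    intro i hi
    have hcont : Continuous (iteratedFDeriv ℝ i E) :=
      hE.continuous_iteratedFDeriv (by exact_mod_cast hi)
    exact exists_bound_of_periodic hcont hP
      (fun k z => iteratedFDeriv_periodic (fun k => hper k z) i k)
  classical
  choose! C hC0 hC using hb
  have hsum : 0 ≤ ∑ i ∈ Finset.range (N + 1), C i :=
    Finset.sum_nonneg fun i hi => hC0 i (Nat.lt_succ_iff.mp (Finset.mem_range.mp hi))
  refine ⟨1 + ∑ i ∈ Finset.range (N + 1), C i, by linarith, ?_⟩
  intro i hi1 hi2 k
  have hle : C i ≤ ∑ i' ∈ Finset.range (N + 1), C i' :=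
    Finset.single_le_sum (fun i' hi' => hC0 i' (Nat.lt_succ_iff.mp (Finset.mem_range.mp hi')))
      (Finset.mem_range.mpr (Nat.lt_succ_of_le hi2))
  calc ‖iteratedFDeriv ℝ i E k‖ ≤ C i := hC i hi2 k
    _ ≤ 1 + ∑ i' ∈ Finset.range (N + 1), C i' := by linarith
    _ ≤ (1 + ∑ i' ∈ Finset.range (N + 1), C i') ^ i := le_self_pow₀ (by linarith) (by omega)

/-! ### Faà di Bruno along the dispersion relation -/

/-- **"Derivatives with respect to `𝐩` can act on `E(𝐩)` or on `χ₁'`"**: if `‖g^{(i)}‖ ≤ C` for `i ≤ m`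
and `‖DⁱE‖ ≤ Dⁱ` for `1 ≤ i ≤ m`, then `‖D^m(g ∘ E)(𝐤)‖ ≤ m!·C·D^m` (Faà di Bruno, Mathlib's
`norm_iteratedFDeriv_comp_le`). [cite: Salmhofer1998, Lemma 4 proof (p.20 L10–13)] -/
theorem norm_iteratedFDeriv_comp_le_of_bounds {g : ℝ → ℂ} {E : (Fin d → ℝ) → ℝ} {m : ℕ}
    (hg : ContDiff ℝ m g) (hE : ContDiff ℝ m E) {C D : ℝ}
    (hC : ∀ i, i ≤ m → ∀ y : ℝ, ‖iteratedDeriv i g y‖ ≤ C)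
    (hD : ∀ i, 1 ≤ i → i ≤ m → ∀ k : Fin d → ℝ, ‖iteratedFDeriv ℝ i E k‖ ≤ D ^ i)
    (k : Fin d → ℝ) : ‖iteratedFDeriv ℝ m (fun k => g (E k)) k‖ ≤ m ! * C * D ^ m := by
  have hcomp : (fun k => g (E k)) = g ∘ E := rfl
  rw [hcomp]
  refine norm_iteratedFDeriv_comp_le hg hE le_rfl k ?_ ?_
  · intro i hi
    rw [norm_iteratedFDeriv_eq_norm_iteratedDeriv]
    exact hC i hi _
  · intro i hi1 hi2
    exact hD i hi1 hi2 k

/-- The operator norm of the `m`-th Fréchet derivative dominates every coordinate partial derivative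
`D^α f(𝐩) = D^m f(𝐩)[e_{j₁},…,e_{j_m}]` (`|α| = m`; the sup norm of a coordinate vector is `≤ 1`): the
sense in which the bounds below, stated for `‖D^m Ḋ̂_t‖`, contain the printed `|D^α Ḋ̂_t|`.
[cite: Salmhofer1998, Lemma 4 (5.18) (p.19 L136–145)] -/
theorem norm_iteratedFDeriv_apply_coord_le {F : Type*} [NormedAddCommGroup F] [NormedSpace ℝ F]
    {m : ℕ} (f : (Fin d → ℝ) → F) (p : Fin d → ℝ) (J : Fin m → Fin d) :
    ‖iteratedFDeriv ℝ m f p (fun i => Pi.single (J i) (1 : ℝ))‖ ≤ ‖iteratedFDeriv ℝ m f p‖ := by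
  refine ((iteratedFDeriv ℝ m f p).le_opNorm _).trans ?_
  have h1 : ∏ i : Fin m, ‖(Pi.single (J i) (1 : ℝ) : Fin d → ℝ)‖ ≤ 1 := by
    refine Finset.prod_le_one (fun _ _ => norm_nonneg _) fun i _ => ?_
    rw [pi_norm_le_iff_of_nonneg zero_le_one]
    intro j
    by_cases h : j = J i
    · subst h; simp
    · simp [Pi.single_eq_of_ne h]
  calc ‖iteratedFDeriv ℝ m f p‖ * ∏ i : Fin m, ‖(Pi.single (J i) (1 : ℝ) : Fin d → ℝ)‖
      ≤ ‖iteratedFDeriv ℝ m f p‖ * 1 := by gcongr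
    _ = ‖iteratedFDeriv ℝ m f p‖ := mul_one _

/-! ### Lemma 4, first sentence: "`C^{k₀}` in `𝐩`" -/

/-- `ix - y ≠ 0` for real `x ≠ 0`, `y`. [cite: Salmhofer1998, §5.4 (5.15) (p.19 L107–113)] -/
theorem I_mul_sub_ne_zero {x : ℝ} (hx : x ≠ 0) (y : ℝ) : Complex.I * (x : ℂ) - (y : ℂ) ≠ 0 := by
  intro h
  have := congrArg Complex.im h
  simp at this
  exact hx this

/-- At positive temperature the step function never vanishes: `ω_β(p₀) ≠ 0` (indeed `|ω_β| ≥ π/β`).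
[cite: Salmhofer1998, §5.4 (5.15) (p.19 L107–113)] -/
theorem omegaStep_ne_zero {β : ℝ} (hβ : 0 < β) (p₀ : ℝ) : omegaStep β p₀ ≠ 0 := by
  have h := pi_div_le_abs_omegaStep hβ p₀
  have hpos : 0 < Real.pi / β := div_pos Real.pi_pos hβ
  intro h0
  rw [h0, abs_zero] at h
  linarith

/-- For `x ≠ 0`, `y ↦ 𝒞_t(x,y) = χ₁(ε_t⁻²(x² + y²))/(ix - y)` is `C^∞` (the denominator does not vanish; `χ₁`
is smooth on `[0,∞)`, realised through its global smooth modification `cutoffExt`).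
[cite: Salmhofer1998, Lemma 4 (p.19 L132–133); (5.17) (p.19 L119–124)] -/
theorem contDiff_covC_snd {χ₁ : ℝ → ℝ} (hχ : IsCutoff χ₁) (eps0 t : ℝ) {x : ℝ} (hx : x ≠ 0) :
    ContDiff ℝ ∞ fun y : ℝ => covC χ₁ eps0 t x y := by
  have hfun : (fun y : ℝ => covC χ₁ eps0 t x y) = fun y : ℝ =>
      ((cutoffExt χ₁ ((epsT eps0 t)⁻¹ ^ 2 * (x ^ 2 + y ^ 2)) : ℝ) : ℂ) *
        (Complex.I * (x : ℂ) - (y : ℂ))⁻¹ := by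
    funext y
    unfold covC
    rw [cutoffExt_eq hχ (by positivity), div_eq_mul_inv]
  rw [hfun]
  have h1 : ContDiff ℝ ∞ fun y : ℝ =>
      ((cutoffExt χ₁ ((epsT eps0 t)⁻¹ ^ 2 * (x ^ 2 + y ^ 2)) : ℝ) : ℂ) :=
    Complex.ofRealCLM.contDiff.comp ((contDiff_cutoffExt hχ).comp
      (contDiff_const.mul (contDiff_const.add (contDiff_id.pow 2))))
  have h2 : ContDiff ℝ ∞ fun y : ℝ => (Complex.I * (x : ℂ) - (y : ℂ))⁻¹ :=
    (contDiff_const.sub Complex.ofRealCLM.contDiff).inv fun y => I_mul_sub_ne_zero hx y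
  exact h1.mul h2

/-- **`D̂_t` is `C^{k₀}` in `𝐩`** (Lemma 4, first sentence), for `β > 0`.
[cite: Salmhofer1998, Lemma 4 (p.19 L132–133)] -/
theorem contDiff_cutoffCovInf_snd {M : ModelData d} (hM : M.Hyp) {χ₁ : ℝ → ℝ} (hχ : IsCutoff χ₁)
    {β : ℝ} (hβ : 0 < β) (t p₀ : ℝ) :
    ContDiff ℝ M.k0 fun q : Mom d => cutoffCovInf M χ₁ β t p₀ q := by
  unfold cutoffCovInf
  exact ((contDiff_covC_snd hχ M.eps0 t (omegaStep_ne_zero hβ p₀)).of_le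
    (mod_cast le_top)).comp hM.contDiff_E

/-- `Ḋ̂_t(p₀,·) = g ∘ E` with `g = ε_t⁻¹Φ(ω_β(p₀)/ε_t, ·/ε_t)` the scaled slice of the profile of `𝒞̇_t`
(toolkit I). [cite: Salmhofer1998, Lemma 4 proof (p.20 L4–6)] -/
theorem deriv_cutoffCovInf_eq_scaledSlice (M : ModelData d) {χ₁ : ℝ → ℝ} (hχ : IsCutoff χ₁)
    (h0 : 0 < M.eps0) (β t p₀ : ℝ) :
    (fun q : Mom d => deriv (fun s : ℝ => cutoffCovInf M χ₁ β s p₀ q) t) =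
      fun q : Mom d => scaledSlice (kerProfile χ₁) (epsT M.eps0 t) (omegaStep β p₀) (M.E q) := by
  funext q
  rw [deriv_cutoffCovInf, covCDot_eq_scaledSlice hχ h0]

/-- **`Ḋ̂_t` is `C^{k₀}` in `𝐩`** (Lemma 4, first sentence; all `β`).
[cite: Salmhofer1998, Lemma 4 (p.19 L132–133)] -/
theorem contDiff_deriv_cutoffCovInf_snd {M : ModelData d} (hM : M.Hyp) {χ₁ : ℝ → ℝ} (hχ : IsCutoff χ₁)
    (β t p₀ : ℝ) :
    ContDiff ℝ M.k0 fun q : Mom d => deriv (fun s : ℝ => cutoffCovInf M χ₁ β s p₀ q) t := by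
  rw [deriv_cutoffCovInf_eq_scaledSlice M hχ hM.eps0_pos]
  exact ((contDiff_scaledSlice (contDiff_kerProfile hχ) _ _).of_le (mod_cast le_top)).comp
    hM.contDiff_E

/-! ### (5.18) for all orders `|α| ≤ k₀` -/

/-- **Support of the `𝐩`-derivatives**: `D^m_𝐩 Ḋ̂_t(p) = 0` whenever `|iω_β(p₀) - E(𝐩)| > ε_t` (the profile
vanishes outside the closed disc of radius `ε_t`, on an open set in `𝐩`).
[cite: Salmhofer1998, Lemma 4 (5.18) (p.19 L136–141); proof p.20 L2–3] -/
theorem iteratedFDeriv_deriv_cutoffCovInf_eq_zero {M : ModelData d} (hM : M.Hyp) {χ₁ : ℝ → ℝ}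
    (hχ : IsCutoff χ₁) (β t p₀ : ℝ) (m : ℕ) {p : Mom d}
    (hp : epsT M.eps0 t < ‖Complex.I * (omegaStep β p₀ : ℂ) - (M.E p : ℂ)‖) :
    iteratedFDeriv ℝ m (fun q : Mom d => deriv (fun s : ℝ => cutoffCovInf M χ₁ β s p₀ q) t) p = 0 := by
  rw [deriv_cutoffCovInf_eq_scaledSlice M hχ hM.eps0_pos]
  have hε : 0 < epsT M.eps0 t := epsT_pos hM.eps0_pos t
  have hc : Continuous fun q : Mom d => ‖Complex.I * (omegaStep β p₀ : ℂ) - (M.E q : ℂ)‖ :=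
    (continuous_const.sub (Complex.continuous_ofReal.comp hM.contDiff_E.continuous)).norm
  have hopen : ∀ᶠ q in 𝓝 p, epsT M.eps0 t < ‖Complex.I * (omegaStep β p₀ : ℂ) - (M.E q : ℂ)‖ :=
    hc.continuousAt.eventually_const_lt hp
  have hev : (fun q : Mom d => scaledSlice (kerProfile χ₁) (epsT M.eps0 t) (omegaStep β p₀) (M.E q))
      =ᶠ[𝓝 p] fun _ => (0 : ℂ) := by
    filter_upwards [hopen] with q hq
    apply scaledSlice_eq_zero (kerProfile_eq_zero hχ) hε
    rw [← normSq_I_mul_sub]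
    have h0 : 0 ≤ epsT M.eps0 t := hε.le
    exact pow_lt_pow_left₀ hq h0 two_ne_zero
  rw [(hev.iteratedFDeriv ℝ m).eq_of_nhds, iteratedFDeriv_fun_zero]
  rfl

/-- **(5.18) for all `|α| ≤ k₀`, both printed lines, with `B₀ = 4`**: there are `B_m > 0` (depending on the
model and on `χ₁` only) such that for all `m ≤ k₀`, all `β`, all `t ≥ 0` and all `p = (p₀, 𝐩)`,
`‖D^m_𝐩 Ḋ̂_t(p)‖ ≤ B_m ε_t^{-1-m} 1(|iω_β(p₀) - E(𝐩)| ≤ ε_t) ≤ B_m ε_t^{-1-m} 1(|ω_β(p₀)| ≤ ε_t) 1(|E(𝐩)| ≤ ε_t)`.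
[cite: Salmhofer1998, Lemma 4 (5.18) (p.19 L136–146); proof p.20 L4–13] -/
theorem exists_bound_display518 {M : ModelData d} (hM : M.Hyp) {χ₁ : ℝ → ℝ} (hχ : IsCutoff χ₁) :
    ∃ B : ℕ → ℝ, B 0 = 4 ∧ (∀ m, 0 < B m) ∧
      ∀ m : ℕ, m ≤ M.k0 → ∀ (β t : ℝ), 0 ≤ t → ∀ (p₀ : ℝ) (p : Mom d),
        ‖iteratedFDeriv ℝ m (fun q : Mom d => deriv (fun s : ℝ => cutoffCovInf M χ₁ β s p₀ q) t) p‖ ≤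
            B m * (epsT M.eps0 t)⁻¹ ^ (m + 1) *
              (if ‖Complex.I * (omegaStep β p₀ : ℂ) - (M.E p : ℂ)‖ ≤ epsT M.eps0 t then (1 : ℝ) else 0) ∧
        B m * (epsT M.eps0 t)⁻¹ ^ (m + 1) *
            (if ‖Complex.I * (omegaStep β p₀ : ℂ) - (M.E p : ℂ)‖ ≤ epsT M.eps0 t then (1 : ℝ) else 0) ≤
          B m * (epsT M.eps0 t)⁻¹ ^ (m + 1) *
            ((if |omegaStep β p₀| ≤ epsT M.eps0 t then (1 : ℝ) else 0) *
              (if |M.E p| ≤ epsT M.eps0 t then (1 : ℝ) else 0)) := by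
  obtain ⟨C, hC0, hC⟩ := exists_bound_iteratedDeriv_scaledSlice (contDiff_kerProfile hχ)
    (hasCompactSupport_kerProfile hχ) M.k0
  have hP : 0 < 2 * Real.pi / M.latt := div_pos (by positivity) hM.latt_pos
  obtain ⟨D, hD1, hD⟩ := exists_bound_iteratedFDeriv_periodic hM.contDiff_E hP
    (fun k z => hM.periodic_E k z)
  have hD0 : 0 ≤ D := by linarith
  refine ⟨fun m => if m = 0 then 4 else m ! * C * D ^ m + 1, by simp, ?_, ?_⟩
  · intro m
    beta_reduce
    split_ifs
    · norm_num
    · have : 0 ≤ (m ! : ℝ) * C * D ^ m := by positivity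
      linarith
  · intro m hm β t ht p₀ p
    beta_reduce
    have hεpos : 0 < epsT M.eps0 t := epsT_pos hM.eps0_pos t
    have hε1 : epsT M.eps0 t ≤ 1 := (epsT_le hM.eps0_pos.le ht).trans hM.eps0_le_one
    have hBm : 0 ≤ (if m = 0 then (4 : ℝ) else m ! * C * D ^ m + 1) := by
      split_ifs
      · norm_num
      · have : 0 ≤ (m ! : ℝ) * C * D ^ m := by positivity
        linarith
    refine ⟨?_, ?_⟩
    · by_cases hshell : ‖Complex.I * (omegaStep β p₀ : ℂ) - (M.E p : ℂ)‖ ≤ epsT M.eps0 t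
      · rw [if_pos hshell, mul_one]
        rcases Nat.eq_zero_or_pos m with hm0 | hmpos
        · subst hm0
          rw [if_pos rfl, norm_iteratedFDeriv_zero, zero_add, pow_one]
          have h := norm_deriv_cutoffCovInf_le M hχ hM.eps0_pos β t p₀ p
          rw [if_pos hshell, mul_one] at h
          exact h
        · rw [if_neg hmpos.ne', deriv_cutoffCovInf_eq_scaledSlice M hχ hM.eps0_pos]
          have hg : ContDiff ℝ m (scaledSlice (kerProfile χ₁) (epsT M.eps0 t) (omegaStep β p₀)) :=
            (contDiff_scaledSlice (contDiff_kerProfile hχ) _ _).of_le (mod_cast le_top)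
          have hEm : ContDiff ℝ m M.E := hM.contDiff_E.of_le (mod_cast hm)
          have hinv1 : 1 ≤ (epsT M.eps0 t)⁻¹ := (one_le_inv₀ hεpos).mpr hε1
          have hCm : ∀ i, i ≤ m → ∀ y : ℝ,
              ‖iteratedDeriv i (scaledSlice (kerProfile χ₁) (epsT M.eps0 t) (omegaStep β p₀)) y‖ ≤
                C * (epsT M.eps0 t)⁻¹ ^ (m + 1) := by
            intro i hi y
            refine (hC _ hεpos _ i (hi.trans hm) y).trans ?_
            exact mul_le_mul_of_nonneg_left (pow_le_pow_right₀ hinv1 (by omega)) hC0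
          have hDm : ∀ i, 1 ≤ i → i ≤ m → ∀ k : Mom d, ‖iteratedFDeriv ℝ i M.E k‖ ≤ D ^ i :=
            fun i hi1 hi2 k => hD i hi1 (hi2.trans hm) k
          have hpow : 0 ≤ (epsT M.eps0 t)⁻¹ ^ (m + 1) := by positivity
          calc ‖iteratedFDeriv ℝ m (fun q : Mom d =>
                  scaledSlice (kerProfile χ₁) (epsT M.eps0 t) (omegaStep β p₀) (M.E q)) p‖
              ≤ m ! * (C * (epsT M.eps0 t)⁻¹ ^ (m + 1)) * D ^ m :=
                norm_iteratedFDeriv_comp_le_of_bounds hg hEm hCm hDm p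
            _ = (m ! * C * D ^ m) * (epsT M.eps0 t)⁻¹ ^ (m + 1) := by ring
            _ ≤ (m ! * C * D ^ m + 1) * (epsT M.eps0 t)⁻¹ ^ (m + 1) := by gcongr; linarith
      · rw [if_neg hshell, mul_zero, iteratedFDeriv_deriv_cutoffCovInf_eq_zero hM hχ β t p₀ m
          (lt_of_not_ge hshell), norm_zero]
    · have hpow : 0 ≤ (epsT M.eps0 t)⁻¹ ^ (m + 1) := by positivity
      exact mul_le_mul_of_nonneg_left (shell_indicator_le M.eps0 t (omegaStep β p₀) (M.E p))
        (mul_nonneg hBm hpow)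

/-! ### (5.19′): the Matsubara count `M_β ≤ (2/π)ε` -/

/-- `{p₀ : |ω_β(p₀)| ≤ ε}` is covered by the intervals `(2πn/β, 2π(n+1)/β]` with `|ω_n| ≤ ε`.
[cite: Salmhofer1998, Lemma 4 proof (5.19′) (p.20 L14–22)] -/
theorem setOf_abs_omegaStep_le_subset {β : ℝ} (hβ : 0 < β) {c : ℝ} {S : Finset ℤ}
    (hS : ∀ n : ℤ, n ∈ S ↔ |matsFreq β n| ≤ c) :
    {p₀ : ℝ | |omegaStep β p₀| ≤ c} ⊆
      ⋃ n ∈ S, Set.Ioc (2 * Real.pi * n / β) (2 * Real.pi * (n + 1) / β) := by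
  intro p₀ hp₀
  simp only [Set.mem_setOf_eq] at hp₀
  have hω : omegaStep β p₀ = matsFreq β (⌈β * p₀ / (2 * Real.pi)⌉ - 1) := rfl
  have hnS : ⌈β * p₀ / (2 * Real.pi)⌉ - 1 ∈ S := (hS _).mpr (hω ▸ hp₀)
  have hmem : p₀ ∈ Set.Ioc (2 * Real.pi * ((⌈β * p₀ / (2 * Real.pi)⌉ - 1 : ℤ) : ℝ) / β)
      (2 * Real.pi * (((⌈β * p₀ / (2 * Real.pi)⌉ - 1 : ℤ) : ℝ) + 1) / β) :=
    (mem_Ioc_iff_ceil_eq hβ p₀ _).mpr rfl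
  exact Set.mem_biUnion hnS hmem

/-- **(5.19′)**: `vol{p₀ ∈ ℝ : |ω_β(p₀)| ≤ ε} ≤ 4ε` for `β > 0`, `ε ≥ 0` — i.e.
`M_β = ∫_ℝ dp₀/(2π) 1(|ω_β(p₀)| ≤ ε) = β⁻¹ #{n ∈ ℤ : |2n+1| ≤ βε/π} ≤ (2/π)ε` (each interval of constancy of
`ω_β` has length `2π/β`, and at most `2βε/π` of them meet the set, `exists_matsubara_support`).
[cite: Salmhofer1998, Lemma 4 proof (5.19′) (p.20 L14–22)] -/
theorem volume_abs_omegaStep_le {β : ℝ} (hβ : 0 < β) {c : ℝ} (hc : 0 ≤ c) :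
    volume {p₀ : ℝ | |omegaStep β p₀| ≤ c} ≤ ENNReal.ofReal (4 * c) := by
  obtain ⟨S, hS, hcard⟩ := exists_matsubara_support hβ hc
  have hπ := Real.pi_pos
  have hlen : ∀ n : ℤ, volume (Set.Ioc (2 * Real.pi * n / β) (2 * Real.pi * (n + 1) / β)) =
      ENNReal.ofReal (2 * Real.pi / β) := by
    intro n
    rw [Real.volume_Ioc]
    congr 1
    field_simp
    ring
  calc volume {p₀ : ℝ | |omegaStep β p₀| ≤ c}
      ≤ volume (⋃ n ∈ S, Set.Ioc (2 * Real.pi * n / β) (2 * Real.pi * (n + 1) / β)) :=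
        measure_mono (setOf_abs_omegaStep_le_subset hβ hS)
    _ ≤ ∑ n ∈ S, volume (Set.Ioc (2 * Real.pi * n / β) (2 * Real.pi * (n + 1) / β)) :=
        measure_biUnion_finset_le S _
    _ = ∑ n ∈ S, ENNReal.ofReal (2 * Real.pi / β) := Finset.sum_congr rfl fun n _ => hlen n
    _ = ENNReal.ofReal (S.card * (2 * Real.pi / β)) := by
        rw [Finset.sum_const, nsmul_eq_mul, ← ENNReal.ofReal_natCast,
          ← ENNReal.ofReal_mul (Nat.cast_nonneg _)]
    _ ≤ ENNReal.ofReal (4 * c) := by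
        apply ENNReal.ofReal_le_ofReal
        have h2 : 0 ≤ 2 * Real.pi / β := by positivity
        calc (S.card : ℝ) * (2 * Real.pi / β) ≤ 2 * β * c / Real.pi * (2 * Real.pi / β) :=
              mul_le_mul_of_nonneg_right hcard h2
          _ = 4 * c := by field_simp; ring

/-! ### "Inserting (5.18) into the integral": integrals of indicator majorants -/

/-- The `p₀`-integral of a function majorised by `A·1(|ω_β(p₀)| ≤ ε)` is at most `A·4ε` ((5.19′)).
[cite: Salmhofer1998, Lemma 4 proof (p.20 L14–22)] -/
theorem lintegral_le_of_le_omegaStep_indicator {β : ℝ} (hβ : 0 < β) {c A : ℝ} (hc : 0 ≤ c)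
    (hA : 0 ≤ A) {F : ℝ → ℝ≥0∞}
    (hF : ∀ p₀, F p₀ ≤ ENNReal.ofReal (A * (if |omegaStep β p₀| ≤ c then (1 : ℝ) else 0))) :
    ∫⁻ p₀, F p₀ ≤ ENNReal.ofReal (A * (4 * c)) := by
  set S : Set ℝ := {p₀ : ℝ | |omegaStep β p₀| ≤ c} with hSdef
  have hle : F ≤ S.indicator (fun _ => ENNReal.ofReal A) := by
    intro p₀
    refine (hF p₀).trans ?_
    by_cases h : |omegaStep β p₀| ≤ c
    · rw [Set.indicator_of_mem (show p₀ ∈ S from h), if_pos h, mul_one]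
    · rw [Set.indicator_of_notMem (show p₀ ∉ S from h), if_neg h, mul_zero, ENNReal.ofReal_zero]
  calc ∫⁻ p₀, F p₀ ≤ ∫⁻ p₀, S.indicator (fun _ => ENNReal.ofReal A) p₀ := lintegral_mono hle
    _ ≤ ENNReal.ofReal A * volume S := lintegral_indicator_const_le _ _
    _ ≤ ENNReal.ofReal A * ENNReal.ofReal (4 * c) := by
        gcongr
        exact volume_abs_omegaStep_le hβ hc
    _ = ENNReal.ofReal (A * (4 * c)) := (ENNReal.ofReal_mul hA).symm

/-- The `ℝ × 𝓑`-integral of a function majorised by `A·1(|ω_β(p₀)| ≤ ε)1(|E(𝐩)| ≤ ε)` is at most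
`A · 4ε · vol{𝐩 ∈ 𝓑 : |E(𝐩)| ≤ ε}` (product of (5.19′) with the shell volume; Tonelli for an indicator).
[cite: Salmhofer1998, Lemma 4 proof (p.20 L14–34)] -/
theorem setLIntegral_prod_le_of_le_indicator (M : ModelData d) {β : ℝ} (hβ : 0 < β) {c A CE : ℝ}
    (hc : 0 ≤ c) (hA : 0 ≤ A)
    (hvol : volume (bzBox d M.latt ∩ {q | |M.E q| ≤ c}) ≤ ENNReal.ofReal (CE * c))
    {F : ℝ × Mom d → ℝ≥0∞}
    (hF : ∀ p : ℝ × Mom d, F p ≤ ENNReal.ofReal (A *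
      ((if |omegaStep β p.1| ≤ c then (1 : ℝ) else 0) * (if |M.E p.2| ≤ c then (1 : ℝ) else 0)))) :
    ∫⁻ p in Set.univ ×ˢ bzBox d M.latt, F p ≤ ENNReal.ofReal (A * (4 * c) * (CE * c)) := by
  set R : Set (ℝ × Mom d) := Set.univ ×ˢ bzBox d M.latt with hRdef
  have hR : MeasurableSet R := MeasurableSet.univ.prod (measurableSet_bzBox d M.latt)
  set S₁ : Set ℝ := {p₀ : ℝ | |omegaStep β p₀| ≤ c} with hS₁
  set S₂ : Set (Mom d) := bzBox d M.latt ∩ {q | |M.E q| ≤ c} with hS₂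
  set T : Set (ℝ × Mom d) := S₁ ×ˢ S₂ with hT
  rw [← lintegral_indicator hR]
  have hle : R.indicator F ≤ T.indicator (fun _ => ENNReal.ofReal A) := by
    intro p
    by_cases hpR : p ∈ R
    · rw [Set.indicator_of_mem hpR]
      refine (hF p).trans ?_
      by_cases h1 : |omegaStep β p.1| ≤ c
      · by_cases h2 : |M.E p.2| ≤ c
        · have hpT : p ∈ T := Set.mk_mem_prod h1 ⟨hpR.2, h2⟩
          rw [Set.indicator_of_mem hpT, if_pos h1, if_pos h2, mul_one, mul_one]
        · rw [if_neg h2, mul_zero, mul_zero, ENNReal.ofReal_zero]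
          exact bot_le
      · rw [if_neg h1, zero_mul, mul_zero, ENNReal.ofReal_zero]
        exact bot_le
    · rw [Set.indicator_of_notMem hpR]
      exact bot_le
  calc ∫⁻ p, R.indicator F p ≤ ∫⁻ p, T.indicator (fun _ => ENNReal.ofReal A) p := lintegral_mono hle
    _ ≤ ENNReal.ofReal A * volume T := lintegral_indicator_const_le _ _
    _ = ENNReal.ofReal A * (volume S₁ * volume S₂) := by
        rw [hT, Measure.volume_eq_prod, Measure.prod_prod]
    _ ≤ ENNReal.ofReal A * (ENNReal.ofReal (4 * c) * ENNReal.ofReal (CE * c)) := by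
        have hv1 := volume_abs_omegaStep_le hβ hc
        gcongr
    _ = ENNReal.ofReal (A * (4 * c) * (CE * c)) := by
        rw [← ENNReal.ofReal_mul (by positivity), ← ENNReal.ofReal_mul (by positivity)]
        congr 1
        ring

/-! ### (5.21) "by integration over `t`" -/

/-- **FTC in the flow parameter**: `D̂_t(p) = -∫_t^T Ḋ̂_s(p) ds` for any `T` beyond `log(βε₀/π)` (where
`D̂_T ≡ 0`). [cite: Salmhofer1998, Lemma 4 proof (p.20 L35–36); Lemma 4 (p.19 L133–135)] -/
theorem cutoffCovInf_eq_neg_integral (M : ModelData d) {χ₁ : ℝ → ℝ} (hχ : IsCutoff χ₁) (h0 : 0 < M.eps0)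
    {β : ℝ} (hβ : 0 < β) (t : ℝ) {T : ℝ} (hT : Real.log (β * M.eps0 / Real.pi) < T)
    (p₀ : ℝ) (p : Mom d) :
    cutoffCovInf M χ₁ β t p₀ p =
      -∫ s in t..T, deriv (fun s : ℝ => cutoffCovInf M χ₁ β s p₀ p) s := by
  have hcd : ContDiff ℝ ((⊤ : ℕ∞) : WithTop ℕ∞) fun s : ℝ => cutoffCovInf M χ₁ β s p₀ p :=
    contDiff_cutoffCovInf M hχ h0 β p₀ p
  have hdiff : Differentiable ℝ fun s : ℝ => cutoffCovInf M χ₁ β s p₀ p :=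
    hcd.differentiable (by simp)
  have hcont : Continuous (deriv fun s : ℝ => cutoffCovInf M χ₁ β s p₀ p) :=
    hcd.continuous_deriv (mod_cast le_top)
  have hFTC := intervalIntegral.integral_eq_sub_of_hasDerivAt
    (f := fun s : ℝ => cutoffCovInf M χ₁ β s p₀ p)
    (f' := deriv fun s : ℝ => cutoffCovInf M χ₁ β s p₀ p) (a := t) (b := T)
    (fun s _ => (hdiff s).hasDerivAt) (hcont.intervalIntegrable _ _)
  have hT0 : cutoffCovInf M χ₁ β T p₀ p = 0 := cutoffCovInf_eq_zero_of_log_lt M hχ h0 hβ hT p₀ p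
  simp only [hT0, zero_sub] at hFTC
  rw [hFTC, neg_neg]

/-- `|D̂_t(p)| ≤ ∫_t^T ds |Ḋ̂_s(p)|` (as an `ℝ≥0∞`-valued inequality).
[cite: Salmhofer1998, Lemma 4 proof (p.20 L35–36)] -/
theorem enorm_cutoffCovInf_le_lintegral (M : ModelData d) {χ₁ : ℝ → ℝ} (hχ : IsCutoff χ₁)
    (h0 : 0 < M.eps0) {β : ℝ} (hβ : 0 < β) {t T : ℝ} (htT : t ≤ T)
    (hT : Real.log (β * M.eps0 / Real.pi) < T) (p₀ : ℝ) (p : Mom d) :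
    ‖cutoffCovInf M χ₁ β t p₀ p‖ₑ ≤
      ∫⁻ s in Set.Ioc t T, ‖deriv (fun s : ℝ => cutoffCovInf M χ₁ β s p₀ p) s‖ₑ := by
  rw [cutoffCovInf_eq_neg_integral M hχ h0 hβ t hT p₀ p, enorm_neg, intervalIntegral.integral_of_le htT]
  exact enorm_integral_le_lintegral_enorm _

/-- The step function `ω_β` is measurable. [cite: Salmhofer1998, §5.4 (5.13) (p.19 L93–98)] -/
theorem measurable_omegaStep (β : ℝ) : Measurable (omegaStep β) := by
  have h1 : Measurable fun p₀ : ℝ => ⌈β * p₀ / (2 * Real.pi)⌉ :=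
    Int.measurable_ceil.comp (by fun_prop : Measurable fun p₀ : ℝ => β * p₀ / (2 * Real.pi))
  have h2 : Measurable fun p₀ : ℝ => (((⌈β * p₀ / (2 * Real.pi)⌉ - 1 : ℤ)) : ℝ) := by
    have h3 : Measurable fun n : ℤ => ((n - 1 : ℤ) : ℝ) := measurable_from_top
    exact h3.comp h1
  have hfun : omegaStep β = fun p₀ : ℝ =>
      Real.pi / β * (2 * (((⌈β * p₀ / (2 * Real.pi)⌉ - 1 : ℤ)) : ℝ) + 1) := by
    funext p₀; rfl
  rw [hfun]
  exact measurable_const.mul ((measurable_const.mul h2).add measurable_const)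

/-- Joint measurability of `(p, s) ↦ Ḋ̂_s(p)` (a continuous profile evaluated at measurable arguments).
[cite: Salmhofer1998, Lemma 4 proof (p.20 L4–6)] -/
theorem measurable_deriv_cutoffCovInf {M : ModelData d} (hM : M.Hyp) {χ₁ : ℝ → ℝ} (hχ : IsCutoff χ₁)
    (β : ℝ) :
    Measurable fun z : (ℝ × Mom d) × ℝ =>
      deriv (fun s : ℝ => cutoffCovInf M χ₁ β s z.1.1 z.1.2) z.2 := by
  have hfun : (fun z : (ℝ × Mom d) × ℝ => deriv (fun s : ℝ => cutoffCovInf M χ₁ β s z.1.1 z.1.2) z.2) =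
      fun z => (((epsT M.eps0 z.2)⁻¹ : ℝ) : ℂ) *
        kerProfile χ₁ (omegaStep β z.1.1 / epsT M.eps0 z.2, M.E z.1.2 / epsT M.eps0 z.2) := by
    funext z
    rw [deriv_cutoffCovInf, covCDot_eq_scaledSlice hχ hM.eps0_pos, scaledSlice_apply]
  rw [hfun]
  have hε : Measurable fun z : (ℝ × Mom d) × ℝ => epsT M.eps0 z.2 := by
    unfold epsT; fun_prop
  have hω : Measurable fun z : (ℝ × Mom d) × ℝ => omegaStep β z.1.1 :=
    (measurable_omegaStep β).comp (measurable_fst.comp measurable_fst)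
  have hE : Measurable fun z : (ℝ × Mom d) × ℝ => M.E z.1.2 :=
    hM.contDiff_E.continuous.measurable.comp (measurable_snd.comp measurable_fst)
  have hΘ : Continuous (kerProfile χ₁) := (contDiff_kerProfile hχ).continuous
  exact (Complex.measurable_ofReal.comp hε.inv).mul
    (hΘ.measurable.comp ((hω.div hε).prodMk (hE.div hε)))

/-- `∫_t^T ε_s ds = ε_t - ε_T ≤ ε_t` ("integration over `t`" of the scale; any `t, T`).
[cite: Salmhofer1998, Lemma 4 proof (p.20 L35–36); (5.8) (p.18 L19–25)] -/
theorem integral_epsT_le {eps0 : ℝ} (h0 : 0 ≤ eps0) (t T : ℝ) :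
    ∫ s in t..T, epsT eps0 s ≤ epsT eps0 t := by
  have hderiv : ∀ s ∈ Set.uIcc t T, HasDerivAt (fun s : ℝ => -epsT eps0 s) (epsT eps0 s) s := by
    intro s _
    unfold epsT
    have h := ((Real.hasDerivAt_exp (-s)).comp s (hasDerivAt_neg s)).const_mul eps0
    have h' := h.neg
    simp only [mul_neg, mul_one, neg_neg] at h'
    exact h'
  have hcont : Continuous fun s : ℝ => epsT eps0 s := by unfold epsT; fun_prop
  rw [intervalIntegral.integral_eq_sub_of_hasDerivAt hderiv (hcont.intervalIntegrable _ _)]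
  have : 0 ≤ epsT eps0 T := mul_nonneg h0 (Real.exp_pos _).le
  linarith

/-- **(5.21) from (5.20) at `α = 0` by integration over `t`**: if the shell volume obeys
`vol{𝐩 ∈ 𝓑 : |E(𝐩)| ≤ ε} ≤ C_E ε` (`0 < ε ≤ 1`), then for `β > 0`, `t ≥ 0`,
`∫_{ℝ×𝓑} d^{d+1}p |D̂_t(p)| ≤ 16 C_E ε_t`. [cite: Salmhofer1998, Lemma 4 (5.21) (p.19 L160–166); proof p.20 L35–36] -/
theorem lintegral_enorm_cutoffCovInf_le {M : ModelData d} (hM : M.Hyp) {χ₁ : ℝ → ℝ} (hχ : IsCutoff χ₁)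
    {β : ℝ} (hβ : 0 < β) {CE : ℝ} (hCE : 0 ≤ CE)
    (hvol : ∀ ε : ℝ, 0 < ε → ε ≤ 1 →
      volume (bzBox d M.latt ∩ {q | |M.E q| ≤ ε}) ≤ ENNReal.ofReal (CE * ε))
    {t : ℝ} (ht : 0 ≤ t) :
    ∫⁻ p in Set.univ ×ˢ bzBox d M.latt, ‖cutoffCovInf M χ₁ β t p.1 p.2‖ₑ ≤
      ENNReal.ofReal (16 * CE * epsT M.eps0 t) := by
  set T : ℝ := max t (Real.log (β * M.eps0 / Real.pi) + 1) with hTdef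
  have htT : t ≤ T := le_max_left _ _
  have hT : Real.log (β * M.eps0 / Real.pi) < T := lt_of_lt_of_le (lt_add_one _) (le_max_right _ _)
  set G : ℝ × Mom d → ℝ → ℝ≥0∞ := fun p s =>
    ‖deriv (fun s : ℝ => cutoffCovInf M χ₁ β s p.1 p.2) s‖ₑ with hGdef
  -- (5.20) at `α = 0` for each `s ≥ 0`
  have h520 : ∀ s : ℝ, 0 ≤ s → ∫⁻ p in Set.univ ×ˢ bzBox d M.latt, G p s ≤
      ENNReal.ofReal (16 * CE * epsT M.eps0 s) := by
    intro s hs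
    have hεs : 0 < epsT M.eps0 s := epsT_pos hM.eps0_pos s
    have hεs1 : epsT M.eps0 s ≤ 1 := (epsT_le hM.eps0_pos.le hs).trans hM.eps0_le_one
    have hA : 0 ≤ 4 * (epsT M.eps0 s)⁻¹ := by positivity
    have h := setLIntegral_prod_le_of_le_indicator M hβ hεs.le hA (hvol _ hεs hεs1) (F := fun p => G p s)
      (fun p => by
        simp only [hGdef]
        rw [← ofReal_norm]
        exact ENNReal.ofReal_le_ofReal (norm_deriv_cutoffCovInf_le' M hχ hM.eps0_pos β s p.1 p.2))
    refine h.trans (le_of_eq ?_)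
    congr 1
    field_simp
    ring
  have hmeas : AEMeasurable (Function.uncurry G)
      ((volume.restrict (Set.univ ×ˢ bzBox d M.latt)).prod (volume.restrict (Set.Ioc t T))) :=
    (measurable_deriv_cutoffCovInf hM hχ β).enorm.aemeasurable
  have hmeas2 : Measurable fun s : ℝ => ENNReal.ofReal (16 * CE * epsT M.eps0 s) := by
    unfold epsT
    exact ENNReal.measurable_ofReal.comp (by fun_prop)
  have hcont : Continuous fun s : ℝ => 16 * CE * epsT M.eps0 s := by unfold epsT; fun_prop
  have hnn : 0 ≤ᵐ[volume.restrict (Set.Ioc t T)] fun s : ℝ => 16 * CE * epsT M.eps0 s :=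
    Filter.Eventually.of_forall fun s => by
      have := (epsT_pos hM.eps0_pos s).le
      positivity
  calc ∫⁻ p in Set.univ ×ˢ bzBox d M.latt, ‖cutoffCovInf M χ₁ β t p.1 p.2‖ₑ
      ≤ ∫⁻ p in Set.univ ×ˢ bzBox d M.latt, ∫⁻ s in Set.Ioc t T, G p s :=
        lintegral_mono fun p => enorm_cutoffCovInf_le_lintegral M hχ hM.eps0_pos hβ htT hT p.1 p.2
    _ = ∫⁻ s in Set.Ioc t T, ∫⁻ p in Set.univ ×ˢ bzBox d M.latt, G p s :=
        lintegral_lintegral_swap hmeas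
    _ ≤ ∫⁻ s in Set.Ioc t T, ENNReal.ofReal (16 * CE * epsT M.eps0 s) :=
        setLIntegral_mono hmeas2 fun s hs => h520 s (ht.trans hs.1.le)
    _ = ENNReal.ofReal (∫ s in Set.Ioc t T, 16 * CE * epsT M.eps0 s) :=
        (ofReal_integral_eq_lintegral_ofReal (hcont.integrableOn_Icc.mono_set Set.Ioc_subset_Icc_self)
          hnn).symm
    _ ≤ ENNReal.ofReal (16 * CE * epsT M.eps0 t) := by
        apply ENNReal.ofReal_le_ofReal
        rw [← intervalIntegral.integral_of_le htT, intervalIntegral.integral_const_mul]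
        exact mul_le_mul_of_nonneg_left (integral_epsT_le hM.eps0_pos.le t T) (by positivity)

/-! ### Lemma 4 assembled: (5.18)–(5.21) with the constants `B_α` and `J₁` -/

/-- `(2π)^{-(d+1)} · 4 ≤ (2π)^{-d}` (i.e. `2/π ≤ 1`): the factor by which the Matsubara count
`M_β ≤ (2/π)ε_t` is rounded up to `ε_t` in (5.19)–(5.21). [cite: Salmhofer1998, Lemma 4 proof (p.20 L19–25)] -/
theorem inv_two_pi_pow_succ_mul_four_le (d : ℕ) :
    ((2 * Real.pi) ^ (d + 1))⁻¹ * 4 ≤ ((2 * Real.pi) ^ d)⁻¹ := by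
  have hπ : 0 < 2 * Real.pi := by positivity
  have hpow : 0 < (2 * Real.pi) ^ d := by positivity
  rw [pow_succ, mul_inv, mul_assoc]
  refine mul_le_of_le_one_right (inv_nonneg.mpr hpow.le) ?_
  rw [inv_mul_le_iff₀ hπ]
  linarith [Real.two_le_pi]

/-- `ε⁻⁽ᵐ⁺¹⁾ · ε = ε⁻ᵐ` for `ε ≠ 0`. [cite: Salmhofer1998, Lemma 4 proof (p.20 L14–25)] -/
theorem inv_pow_succ_mul_self {ε : ℝ} (hε : ε ≠ 0) (m : ℕ) : ε⁻¹ ^ (m + 1) * ε = ε⁻¹ ^ m := by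
  rw [pow_succ, mul_assoc, inv_mul_cancel₀ hε, mul_one]

/-- **Lemma 4 of [Salmhofer1998] (p.19 L132–166) for the §2.3 class of models, completed.**  For a
many-fermion model `M` satisfying the hypotheses of §2.3 and a cutoff `χ₁` as in §4.1 there are constants
`B_m > 0` (`m ∈ ℕ`, `B₀ = 4`) and `J₁ > 0`, depending on `M` and `χ₁` only, such that, writing
`D̂_t(p) = 𝒞_t(ω_β(p₀), E(𝐩))` (`cutoffCovInf`), `Ḋ̂_t = ∂_t D̂_t` and `ε_t = ε₀e^{-t}`:
* (the meaning of `J₁`) `∫_𝓑 d^d𝐩/(2π)^d 1(|E(𝐩)| ≤ ε) ≤ 2J₁ε` for all `0 < ε ≤ 1` — in print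
  `J₁ = sup_ρ ∫dθ |J(ρ,θ)|` enters only through this inequality (p.20 L28–34); here it is obtained from the
  shell-volume bound of toolkit III instead of the low-energy chart;
and for all `β > 0` and all `t ≥ 0`:
* `D̂_t(p₀, ·)` and `Ḋ̂_t(p₀, ·)` are `C^{k₀}` in `𝐩` (Lemma 4, first sentence; boundedness, `C^∞` in `t` and
  `D̂_t ≡ 0` for `t > log(βε₀/π)` are `norm_cutoffCovInf_le`, `contDiff_cutoffCovInf`,
  `cutoffCovInf_eq_zero_of_log_lt` of `Salmhofer1998Sec5PropagatorLemmas`);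
* **(5.18)** for all `m ≤ k₀` and all `p`: `‖D^m_𝐩 Ḋ̂_t(p)‖ ≤ B_m ε_t^{-1-m} 1(|iω_β(p₀) - E(𝐩)| ≤ ε_t)
  ≤ B_m ε_t^{-1-m} 1(|ω_β(p₀)| ≤ ε_t) 1(|E(𝐩)| ≤ ε_t)`;
* **(5.19)** for all `m ≤ k₀` and all `𝐩`: `∫_ℝ dp₀/(2π) ‖D^m_𝐩 Ḋ̂_t(p)‖ ≤ B_m ε_t^{-m} 1(|E(𝐩)| ≤ ε_t)`;
* **(5.20)** for all `m ≤ k₀`: `∫_{ℝ×𝓑} d^{d+1}p/(2π)^{d+1} ‖D^m_𝐩 Ḋ̂_t(p)‖ ≤ 2J₁B_m ε_t^{1-m}`;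
* **(5.21)** `∫_{ℝ×𝓑} d^{d+1}p/(2π)^{d+1} |D̂_t(p)| ≤ 8J₁ε_t`, i.e. `Display521 M χ₁ β J₁ t`.
`D^m_𝐩` is the `m`-th Fréchet derivative in `𝐩` (it dominates each printed partial `D^α`, `|α| = m`,
`norm_iteratedFDeriv_apply_coord_le`); integrals are Lebesgue integrals of the norms (`∫⁻`, no
integrability side condition); print's restriction "`t ≤ log(βε₀/π)`" for (5.19)–(5.21) is not needed.
[cite: Salmhofer1998, Lemma 4 (5.18)–(5.21) (p.19 L132–166); proof p.20 L1–36] -/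
theorem lemma4 {M : ModelData d} (hM : M.Hyp) {χ₁ : ℝ → ℝ} (hχ : IsCutoff χ₁) :
    ∃ (B : ℕ → ℝ) (J₁ : ℝ), B 0 = 4 ∧ (∀ m, 0 < B m) ∧ 0 < J₁ ∧
      (∀ ε : ℝ, 0 < ε → ε ≤ 1 →
        ENNReal.ofReal (((2 * Real.pi) ^ d)⁻¹) * volume (bzBox d M.latt ∩ {p | |M.E p| ≤ ε}) ≤
          ENNReal.ofReal (2 * J₁ * ε)) ∧
      ∀ β : ℝ, 0 < β → ∀ t : ℝ, 0 ≤ t →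
        -- Lemma 4, first sentence: `C^{k₀}` in `𝐩`
        (∀ p₀ : ℝ, ContDiff ℝ M.k0 (fun q : Mom d => cutoffCovInf M χ₁ β t p₀ q) ∧
          ContDiff ℝ M.k0 (fun q : Mom d => deriv (fun s : ℝ => cutoffCovInf M χ₁ β s p₀ q) t)) ∧
        -- (5.18), both lines
        (∀ m : ℕ, m ≤ M.k0 → ∀ (p₀ : ℝ) (p : Mom d),
          ‖iteratedFDeriv ℝ m (fun q : Mom d => deriv (fun s : ℝ => cutoffCovInf M χ₁ β s p₀ q) t) p‖ ≤
              B m * (epsT M.eps0 t)⁻¹ ^ (m + 1) *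
                (if ‖Complex.I * (omegaStep β p₀ : ℂ) - (M.E p : ℂ)‖ ≤ epsT M.eps0 t then (1 : ℝ)
                  else 0) ∧
          B m * (epsT M.eps0 t)⁻¹ ^ (m + 1) *
              (if ‖Complex.I * (omegaStep β p₀ : ℂ) - (M.E p : ℂ)‖ ≤ epsT M.eps0 t then (1 : ℝ)
                else 0) ≤
            B m * (epsT M.eps0 t)⁻¹ ^ (m + 1) *
              ((if |omegaStep β p₀| ≤ epsT M.eps0 t then (1 : ℝ) else 0) *
                (if |M.E p| ≤ epsT M.eps0 t then (1 : ℝ) else 0))) ∧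
        -- (5.19)
        (∀ m : ℕ, m ≤ M.k0 → ∀ p : Mom d,
          ENNReal.ofReal ((2 * Real.pi)⁻¹) *
              ∫⁻ p₀ : ℝ, ‖iteratedFDeriv ℝ m
                (fun q : Mom d => deriv (fun s : ℝ => cutoffCovInf M χ₁ β s p₀ q) t) p‖ₑ ≤
            ENNReal.ofReal (B m * (epsT M.eps0 t)⁻¹ ^ m *
              (if |M.E p| ≤ epsT M.eps0 t then (1 : ℝ) else 0))) ∧
        -- (5.20)
        (∀ m : ℕ, m ≤ M.k0 →
          ENNReal.ofReal (((2 * Real.pi) ^ (d + 1))⁻¹) *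
              ∫⁻ p in Set.univ ×ˢ bzBox d M.latt, ‖iteratedFDeriv ℝ m
                (fun q : Mom d => deriv (fun s : ℝ => cutoffCovInf M χ₁ β s p.1 q) t) p.2‖ₑ ≤
            ENNReal.ofReal (2 * J₁ * B m * ((epsT M.eps0 t)⁻¹ ^ m * epsT M.eps0 t))) ∧
        -- (5.21)
        Display521 M χ₁ β J₁ t := by
  obtain ⟨B, hB0, hBpos, h518⟩ := exists_bound_display518 hM hχ
  obtain ⟨CE, hCE0, hCE⟩ := exists_sublevel_volume_le hM
  -- enlarge the shell-volume constant so that `J₁ > 0`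
  set C : ℝ := CE + 1 with hCdef
  have hCpos : 0 < C := by rw [hCdef]; linarith
  have hvol : ∀ ε : ℝ, 0 < ε → ε ≤ 1 →
      volume (bzBox d M.latt ∩ {q | |M.E q| ≤ ε}) ≤ ENNReal.ofReal (C * ε) := by
    intro ε hε hε1
    refine (hCE ε hε hε1).trans (ENNReal.ofReal_le_ofReal ?_)
    rw [hCdef]
    nlinarith
  have h2π : 0 < 2 * Real.pi := by positivity
  have hπd : 0 < (2 * Real.pi) ^ d := by positivity
  have hπd1 : 0 < (2 * Real.pi) ^ (d + 1) := by positivity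
  have hkey := inv_two_pi_pow_succ_mul_four_le d
  set J₁ : ℝ := C / (2 * (2 * Real.pi) ^ d) with hJdef
  have hJpos : 0 < J₁ := by rw [hJdef]; positivity
  have hJ2 : 2 * J₁ = C * ((2 * Real.pi) ^ d)⁻¹ := by rw [hJdef]; field_simp
  refine ⟨B, J₁, hB0, hBpos, hJpos, ?_, ?_⟩
  · -- the meaning of `J₁`
    intro ε hε hε1
    calc ENNReal.ofReal (((2 * Real.pi) ^ d)⁻¹) * volume (bzBox d M.latt ∩ {p | |M.E p| ≤ ε})
        ≤ ENNReal.ofReal (((2 * Real.pi) ^ d)⁻¹) * ENNReal.ofReal (C * ε) := by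
          gcongr
          exact hvol ε hε hε1
      _ = ENNReal.ofReal (2 * J₁ * ε) := by
          rw [← ENNReal.ofReal_mul (inv_nonneg.mpr hπd.le), hJ2]
          congr 1
          ring
  · intro β hβ t ht
    have hε : 0 < epsT M.eps0 t := epsT_pos hM.eps0_pos t
    have hε1 : epsT M.eps0 t ≤ 1 := (epsT_le hM.eps0_pos.le ht).trans hM.eps0_le_one
    have hid : ∀ m : ℕ, (epsT M.eps0 t)⁻¹ ^ (m + 1) * epsT M.eps0 t = (epsT M.eps0 t)⁻¹ ^ m :=
      fun m => inv_pow_succ_mul_self hε.ne' m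
    refine ⟨fun p₀ => ⟨contDiff_cutoffCovInf_snd hM hχ hβ t p₀,
      contDiff_deriv_cutoffCovInf_snd hM hχ β t p₀⟩, fun m hm p₀ p => h518 m hm β t ht p₀ p, ?_, ?_, ?_⟩
    · -- (5.19): "Inserting (5.18) into the integral in (5.19) gives ... `M_β`"
      intro m hm p
      have hBm : 0 ≤ B m := (hBpos m).le
      set A : ℝ := B m * (epsT M.eps0 t)⁻¹ ^ (m + 1) *
        (if |M.E p| ≤ epsT M.eps0 t then (1 : ℝ) else 0) with hAdef
      have hind : 0 ≤ (if |M.E p| ≤ epsT M.eps0 t then (1 : ℝ) else 0) := by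
        split_ifs <;> norm_num
      have hA : 0 ≤ A := by rw [hAdef]; positivity
      have hF : ∀ p₀ : ℝ, (‖iteratedFDeriv ℝ m
          (fun q : Mom d => deriv (fun s : ℝ => cutoffCovInf M χ₁ β s p₀ q) t) p‖ₑ : ℝ≥0∞) ≤
          ENNReal.ofReal (A * (if |omegaStep β p₀| ≤ epsT M.eps0 t then (1 : ℝ) else 0)) := by
        intro p₀
        rw [← ofReal_norm]
        apply ENNReal.ofReal_le_ofReal
        have h := (h518 m hm β t ht p₀ p).1.trans (h518 m hm β t ht p₀ p).2
        rw [hAdef]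
        linarith [h]
      have hint := lintegral_le_of_le_omegaStep_indicator hβ hε.le hA hF
      calc ENNReal.ofReal ((2 * Real.pi)⁻¹) * ∫⁻ p₀ : ℝ, ‖iteratedFDeriv ℝ m
              (fun q : Mom d => deriv (fun s : ℝ => cutoffCovInf M χ₁ β s p₀ q) t) p‖ₑ
          ≤ ENNReal.ofReal ((2 * Real.pi)⁻¹) * ENNReal.ofReal (A * (4 * epsT M.eps0 t)) := by
            gcongr
        _ = ENNReal.ofReal ((2 * Real.pi)⁻¹ * (A * (4 * epsT M.eps0 t))) :=
            (ENNReal.ofReal_mul (inv_nonneg.mpr h2π.le)).symm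
        _ ≤ ENNReal.ofReal (B m * (epsT M.eps0 t)⁻¹ ^ m *
              (if |M.E p| ≤ epsT M.eps0 t then (1 : ℝ) else 0)) := by
            apply ENNReal.ofReal_le_ofReal
            have hk0 := inv_two_pi_pow_succ_mul_four_le 0
            rw [zero_add, pow_one, pow_zero, inv_one] at hk0
            have hrhs : 0 ≤ B m * (epsT M.eps0 t)⁻¹ ^ m *
                (if |M.E p| ≤ epsT M.eps0 t then (1 : ℝ) else 0) := by positivity
            calc (2 * Real.pi)⁻¹ * (A * (4 * epsT M.eps0 t))
                = ((2 * Real.pi)⁻¹ * 4) * (B m * ((epsT M.eps0 t)⁻¹ ^ (m + 1) * epsT M.eps0 t) *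
                    (if |M.E p| ≤ epsT M.eps0 t then (1 : ℝ) else 0)) := by rw [hAdef]; ring
              _ = ((2 * Real.pi)⁻¹ * 4) * (B m * (epsT M.eps0 t)⁻¹ ^ m *
                    (if |M.E p| ≤ epsT M.eps0 t then (1 : ℝ) else 0)) := by rw [hid m]
              _ ≤ 1 * (B m * (epsT M.eps0 t)⁻¹ ^ m *
                    (if |M.E p| ≤ epsT M.eps0 t then (1 : ℝ) else 0)) :=
                  mul_le_mul_of_nonneg_right hk0 hrhs
              _ = _ := one_mul _
    · -- (5.20): "This gives for the integral in (5.20) ... `≤ 2J₁ε_t`"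
      intro m hm
      have hBm : 0 ≤ B m := (hBpos m).le
      set A : ℝ := B m * (epsT M.eps0 t)⁻¹ ^ (m + 1) with hAdef
      have hA : 0 ≤ A := by rw [hAdef]; positivity
      have hF : ∀ p : ℝ × Mom d, (‖iteratedFDeriv ℝ m
          (fun q : Mom d => deriv (fun s : ℝ => cutoffCovInf M χ₁ β s p.1 q) t) p.2‖ₑ : ℝ≥0∞) ≤
          ENNReal.ofReal (A * ((if |omegaStep β p.1| ≤ epsT M.eps0 t then (1 : ℝ) else 0) *
            (if |M.E p.2| ≤ epsT M.eps0 t then (1 : ℝ) else 0))) := by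
        intro p
        rw [← ofReal_norm]
        apply ENNReal.ofReal_le_ofReal
        rw [hAdef]
        exact (h518 m hm β t ht p.1 p.2).1.trans (h518 m hm β t ht p.1 p.2).2
      have hint := setLIntegral_prod_le_of_le_indicator M hβ hε.le hA (hvol _ hε hε1) hF
      calc ENNReal.ofReal (((2 * Real.pi) ^ (d + 1))⁻¹) *
            ∫⁻ p in Set.univ ×ˢ bzBox d M.latt, ‖iteratedFDeriv ℝ m
              (fun q : Mom d => deriv (fun s : ℝ => cutoffCovInf M χ₁ β s p.1 q) t) p.2‖ₑ
          ≤ ENNReal.ofReal (((2 * Real.pi) ^ (d + 1))⁻¹) *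
              ENNReal.ofReal (A * (4 * epsT M.eps0 t) * (C * epsT M.eps0 t)) := by gcongr
        _ = ENNReal.ofReal (((2 * Real.pi) ^ (d + 1))⁻¹ *
              (A * (4 * epsT M.eps0 t) * (C * epsT M.eps0 t))) :=
            (ENNReal.ofReal_mul (inv_nonneg.mpr hπd1.le)).symm
        _ ≤ ENNReal.ofReal (2 * J₁ * B m * ((epsT M.eps0 t)⁻¹ ^ m * epsT M.eps0 t)) := by
            apply ENNReal.ofReal_le_ofReal
            have hrhs : 0 ≤ B m * C * ((epsT M.eps0 t)⁻¹ ^ m * epsT M.eps0 t) := by positivity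
            calc ((2 * Real.pi) ^ (d + 1))⁻¹ * (A * (4 * epsT M.eps0 t) * (C * epsT M.eps0 t))
                = (((2 * Real.pi) ^ (d + 1))⁻¹ * 4) *
                    (B m * C * (((epsT M.eps0 t)⁻¹ ^ (m + 1) * epsT M.eps0 t) * epsT M.eps0 t)) := by
                  rw [hAdef]; ring
              _ = (((2 * Real.pi) ^ (d + 1))⁻¹ * 4) *
                    (B m * C * ((epsT M.eps0 t)⁻¹ ^ m * epsT M.eps0 t)) := by rw [hid m]
              _ ≤ ((2 * Real.pi) ^ d)⁻¹ * (B m * C * ((epsT M.eps0 t)⁻¹ ^ m * epsT M.eps0 t)) :=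
                  mul_le_mul_of_nonneg_right hkey hrhs
              _ = 2 * J₁ * B m * ((epsT M.eps0 t)⁻¹ ^ m * epsT M.eps0 t) := by rw [hJ2]; ring
    · -- (5.21): "follows by integration over `t`"
      unfold Display521 covL1Momentum
      have hint := lintegral_enorm_cutoffCovInf_le hM hχ hβ hCpos.le hvol ht
      calc ENNReal.ofReal (((2 * Real.pi) ^ (d + 1))⁻¹) *
            ∫⁻ p in Set.univ ×ˢ bzBox d M.latt, ‖cutoffCovInf M χ₁ β t p.1 p.2‖ₑ
          ≤ ENNReal.ofReal (((2 * Real.pi) ^ (d + 1))⁻¹) * ENNReal.ofReal (16 * C * epsT M.eps0 t) := by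
            gcongr
        _ = ENNReal.ofReal (((2 * Real.pi) ^ (d + 1))⁻¹ * (16 * C * epsT M.eps0 t)) :=
            (ENNReal.ofReal_mul (inv_nonneg.mpr hπd1.le)).symm
        _ ≤ ENNReal.ofReal (8 * J₁ * epsT M.eps0 t) := by
            apply ENNReal.ofReal_le_ofReal
            have hrhs : 0 ≤ 4 * C * epsT M.eps0 t := by positivity
            calc ((2 * Real.pi) ^ (d + 1))⁻¹ * (16 * C * epsT M.eps0 t)
                = (((2 * Real.pi) ^ (d + 1))⁻¹ * 4) * (4 * C * epsT M.eps0 t) := by ring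
              _ ≤ ((2 * Real.pi) ^ d)⁻¹ * (4 * C * epsT M.eps0 t) :=
                  mul_le_mul_of_nonneg_right hkey hrhs
              _ = 8 * J₁ * epsT M.eps0 t := by
                  rw [show (8 : ℝ) * J₁ = 4 * (2 * J₁) by ring, hJ2]; ring

/-- **(5.21) in the shape consumers take** (cf. the hypothesis `∫|D̂_t| ≤ 8J₁ε₀e^{-t}` of Theorem 2,
`ManyFermionGreenFunctionBound`, F7b): there is `J₁ > 0`, depending on the model and `χ₁` only, with
`Display521 M χ₁ β J₁ t` — `∫_{ℝ×𝓑} d^{d+1}p/(2π)^{d+1} |D̂_t(p)| ≤ 8J₁ε_t` — for all `β > 0` and all `t ≥ 0`,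
and `∫_𝓑 d^d𝐩/(2π)^d 1(|E(𝐩)| ≤ ε) ≤ 2J₁ε` for `0 < ε ≤ 1`.
[cite: Salmhofer1998, Lemma 4 (5.21) (p.19 L160–166); proof p.20 L26–36] -/
theorem exists_display521 {M : ModelData d} (hM : M.Hyp) {χ₁ : ℝ → ℝ} (hχ : IsCutoff χ₁) :
    ∃ J₁ : ℝ, 0 < J₁ ∧
      (∀ ε : ℝ, 0 < ε → ε ≤ 1 →
        ENNReal.ofReal (((2 * Real.pi) ^ d)⁻¹) * volume (bzBox d M.latt ∩ {p | |M.E p| ≤ ε}) ≤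
          ENNReal.ofReal (2 * J₁ * ε)) ∧
      ∀ β : ℝ, 0 < β → ∀ t : ℝ, 0 ≤ t → Display521 M χ₁ β J₁ t := by
  obtain ⟨_, J₁, _, _, hJ, hvol, h⟩ := lemma4 hM hχ
  exact ⟨J₁, hJ, hvol, fun β hβ t ht => (h β hβ t ht).2.2.2.2⟩

end Salmhofer1998

end Literature.MathematicalPhysics.QuantumLattice.FermiRG
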